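import Literature.MathematicalPhysics.QuantumLattice.ContractionResidualBound
import Literature.MathematicalPhysics.QuantumLattice.LadderWordCharge
import HarnessLib

/-!
# Ventures/CertifiedQuantumChemistry — Rows/CARNormalOrder.lean: a kernel-executable CAR normal-ordering engine
# (part 1: the computable engine; part 2 `Rows/CARNormalOrderSound.lean` proves it sound against the tree's ladder words)

HONEST FRAMING (verbatim): certified bounds for a stated model Hamiltonian in a stated basis; not a
claim about the real molecule beyond that model.

var-2 (gen 17), zero compute; definitions + list lemmas only (no claim node, no model, NO BOUND ASSERTED).

Purpose. The cell's LOWER claim nodes `cert_… : LowerCertificate F a b lo` (`Rows/SectorRows.lean`) assert an exact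
sum-of-squares / dual OPERATOR IDENTITY in the CAR algebra of the `2k` spin orbitals (FORMAT-qcl1 §2: `H_F − bound·1 =
Σ_b Σ_{XY} G_b[X,Y] O_X† O_Y + Σ_r λ_r (ideal rows) + Σ_i p_i (words of norm ≤ 1)`). Such an identity cannot be checked by
evaluating `4^k × 4^k` matrices, but it CAN be checked symbolically: expand every product of creation / annihilation
letters into NORMAL-ORDERED monomials with the canonical anticommutation relations and compare coefficients. This file is
that symbolic engine, as computable `List` functions the kernel evaluates (`decide +kernel`):

* syntax: letters `α × Bool` over any linearly ordered letter type `α` (`true` = creation, as in `ladderLetter`),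
  monomials `Mono α = List α × List α` (creator string, annihilator string; word = creators then annihilators in list
  order), polynomials `Poly α = List (Mono α × ℚ)`;
* `prependCre`, `insAnn`, `prependAnn`, `prependLetter`, `wordToPoly`, `termsToPoly` — normal ordering by the CAR
  (`a_x a†_y = δ_xy − a†_y a_x`, `a_x a_y = −a_y a_x`, `a_x a_x = 0`, same for creators);
* `collect` = key-tagged bottom-up merge sort (`mergeStep`/`mergeByKey`/`mergePairs`/`mergeAll`, structurally recursive,
  no `length`, no well-founded recursion) + `mergeAdj` (equal adjacent monomials merged, zeros dropped), with the
  permutation lemmas `…_perm`; `normalize = collect ∘ termsToPoly`;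
* `constCoeff`, `l1Nonconst`, `lowerConst = constCoeff − l1Nonconst`, accumulated tail-recursively through `qforce`
  (re-assembles a rational from its forced numerator / denominator, `qforce_eq : qforce q = q`) so that the kernel's lazy
  sums stay flat on lists of tens of thousands of terms.
Kernel-engineering record (var-2 g17 NOTES): every loop is structural (`List.rec` / nested patterns), no `let` in hot paths,
sort keys are packed naturals (`Mono.key`), and a whole certificate is replayed block by block because one monolithic
evaluation exceeds the kernel's memory budget (`Rows/SOSDualReplay.lean`).

References: O. Bratteli, D. W. Robinson, *Operator Algebras and Quantum Statistical Mechanics 2*, §5.2.2 (CAR,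
(5.2.11)–(5.2.12)); T. Helgaker, P. Jørgensen, J. Olsen, *Molecular Electronic-Structure Theory* (2000) §1.8 (normal
ordering); FORMAT-qcl1 v0.3.0 §2–§7 (HOME `pub-qchem-rdm/`).
-/

namespace Summit.Ventures.CertifiedQuantumChemistry

namespace CARPoly

/-! ## Syntax (no order needed) -/

section Syntax

variable {α : Type*}

/-- A monomial: (creator letters, annihilator letters); denotes `a†_{c₁} ⋯ a†_{cₘ} a_{d₁} ⋯ a_{dₙ}` in list order
(normal-ordered when both lists are strictly increasing, which the engine maintains but soundness never uses). -/
abbrev Mono (α : Type*) := List α × List α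

/-- A polynomial: a list of (monomial, rational coefficient), denoting the sum. -/
abbrev Poly (α : Type*) := List (Mono α × ℚ)

/-- The ladder word (letters `α × Bool`, `true` = creation) a monomial denotes. -/
def Mono.word (m : Mono α) : List (α × Bool) := m.1.map (fun a => (a, true)) ++ m.2.map (fun a => (a, false))

/-- The unit monomial (empty word, denotes `1`). -/
def Mono.unit : Mono α := ([], [])

/-- Boolean test for the unit monomial. -/
def Mono.isUnit (m : Mono α) : Bool := m.1.isEmpty && m.2.isEmpty

/-- A packed natural-number sort key of a monomial (letters encoded by `enc`, base `B`); only used to sort, never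
trusted. -/
def Mono.key (enc : α → ℕ) (B : ℕ) (m : Mono α) : ℕ :=
  (m.2.map fun a => enc a + 1).foldl (fun acc v => acc * B + v)
    (((m.1.map fun a => enc a + 1).foldl (fun acc v => acc * B + v) 0) * B)

/-- Re-assemble a rational from its numerator and denominator AFTER forcing both to literals (a match on the
`Int` / `Nat` constructors): the identity function, used to keep the kernel's lazily accumulated sums flat. -/
def qforce (q : ℚ) : ℚ :=
  match q.num, q.den with
  | Int.ofNat n, d + 1 => mkRat (Int.ofNat n) (d + 1)
  | Int.negSucc n, d + 1 => mkRat (Int.negSucc n) (d + 1)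
  | _, 0 => q

/-- `qforce` is the identity on `ℚ`. -/
theorem qforce_eq (q : ℚ) : qforce q = q := by
  unfold qforce
  split
  · rename_i h1 h2
    rw [Nat.succ_eq_add_one] at h2
    rw [← h1, ← h2, Rat.mkRat_self]
  · rename_i h1 h2
    rw [Nat.succ_eq_add_one] at h2
    rw [← h1, ← h2, Rat.mkRat_self]
  · rfl

/-- Push a (monomial, coefficient) unless the coefficient is zero. -/
def emit (m : Mono α) (q : ℚ) (rest : Poly α) : Poly α := if q = 0 then rest else (m, q) :: rest

/-- Contribution of one term to the constant coefficient. -/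
def constPart (mq : Mono α × ℚ) : ℚ := if mq.1.isUnit then mq.2 else 0

/-- Contribution of one term to the `ℓ¹` norm of the non-unit coefficients. -/
def l1Part (mq : Mono α × ℚ) : ℚ := if mq.1.isUnit then 0 else |mq.2|

/-- Sum of the coefficients of the unit monomial (tail-recursive accumulation: the kernel evaluates it on lists of
tens of thousands of terms). -/
def constCoeff (P : Poly α) : ℚ := P.foldl (fun acc mq => qforce (acc + constPart mq)) 0

/-- `ℓ¹` norm of the coefficients of the non-unit monomials (tail-recursive accumulation). -/
def l1Nonconst (P : Poly α) : ℚ := P.foldl (fun acc mq => qforce (acc + l1Part mq)) 0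

/-- Shifting the accumulator out of a (forced) additive left fold. -/
theorem foldl_add_eq {β : Type*} (g : β → ℚ) : ∀ (a : ℚ) (P : List β),
    P.foldl (fun acc b => qforce (acc + g b)) a = a + P.foldl (fun acc b => qforce (acc + g b)) 0
  | a, [] => by simp
  | a, b :: P => by
    rw [List.foldl_cons, List.foldl_cons, qforce_eq, qforce_eq, foldl_add_eq g (a + g b), foldl_add_eq g (0 + g b)]
    ring

/-- `constCoeff` of a cons. -/
theorem constCoeff_cons (mq : Mono α × ℚ) (P : Poly α) : constCoeff (mq :: P) = constPart mq + constCoeff P := by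
  unfold constCoeff
  rw [List.foldl_cons, foldl_add_eq, qforce_eq, zero_add]

/-- `l1Nonconst` of a cons. -/
theorem l1Nonconst_cons (mq : Mono α × ℚ) (P : Poly α) : l1Nonconst (mq :: P) = l1Part mq + l1Nonconst P := by
  unfold l1Nonconst
  rw [List.foldl_cons, foldl_add_eq, qforce_eq, zero_add]

/-- The certified constant of a polynomial: `constCoeff − l1Nonconst` (a lower bound of its numerical range per unit
norm, `re_quadForm_evalPoly_ge`). -/
def lowerConst (P : Poly α) : ℚ := constCoeff P - l1Nonconst P

/-- `isUnit` tests for the unit monomial. -/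
theorem Mono.isUnit_eq_true_iff (m : Mono α) : m.isUnit = true ↔ m = Mono.unit := by
  obtain ⟨C, A⟩ := m
  simp only [Mono.isUnit, Bool.and_eq_true, List.isEmpty_iff, Mono.unit, Prod.mk.injEq]

end Syntax

/-! ## Normal ordering (computable) -/

section Engine

variable {α : Type*} [LinearOrder α]

/-- Normal form of `a†_x · (a†_C a_A)`: insert `x` into the creator string with the sign of the transpositions,
nothing if `x ∈ C`. -/
def prependCre (x : α) : List α → List α → Poly α
  | [], A => [(([x], A), 1)]
  | c :: C, A =>
    if x < c then [((x :: c :: C, A), 1)]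
    else if x = c then []
    else (prependCre x C A).map fun mq => ((c :: mq.1.1, mq.1.2), -mq.2)

/-- Normal form of `a_x · (a_A)` (no creators): insert `x` into the annihilator string with sign, nothing if `x ∈ A`. -/
def insAnn (x : α) : List α → Poly α
  | [] => [(([], [x]), 1)]
  | a :: A =>
    if x < a then [(([], x :: a :: A), 1)]
    else if x = a then []
    else (insAnn x A).map fun mq => (([], a :: mq.1.2), -mq.2)

/-- Normal form of `a_x · (a†_C a_A)`: move `a_x` through the creators by `a_x a†_c = δ_{xc} − a†_c a_x`
(one contraction term per matching creator), then insert it among the annihilators. -/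
def prependAnn (x : α) : List α → List α → Poly α
  | [], A => insAnn x A
  | c :: C, A =>
    (if x = c then [((C, A), 1)] else []) ++
      (prependAnn x C A).map fun mq => ((c :: mq.1.1, mq.1.2), -mq.2)

/-- Normal form of `letter · monomial`. -/
def prependLetter (l : α × Bool) (m : Mono α) : Poly α :=
  if l.2 then prependCre l.1 m.1 m.2 else prependAnn l.1 m.1 m.2

/-- `letter · polynomial`, term by term (coefficients multiplied through). -/
def prependLetterPoly (l : α × Bool) (P : Poly α) : Poly α :=
  P.flatMap fun mq => (prependLetter l mq.1).map fun mq' => (mq'.1, mq.2 * mq'.2)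

/-- Normal form of a ladder word (processed from the right). -/
def wordToPoly : List (α × Bool) → Poly α
  | [] => [(Mono.unit, 1)]
  | l :: w => prependLetterPoly l (wordToPoly w)

/-- Normal form (uncollected) of a term list `Σ_t c_t · word_t`. -/
def termsToPoly (T : List (List (α × Bool) × ℚ)) : Poly α :=
  T.flatMap fun wc => (wordToPoly wc.1).map fun mq => (mq.1, wc.2 * mq.2)

/-- Merge runs of equal adjacent monomials, adding coefficients and dropping zeros (structural in the list; the
current monomial and its accumulated coefficient are carried). -/
def mergeAdj : Mono α → ℚ → Poly α → Poly α
  | m, q, [] => emit m q []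
  | m, q, mq :: rest => if m = mq.1 then mergeAdj m (qforce (q + mq.2)) rest else emit m q (mergeAdj mq.1 mq.2 rest)

end Engine

/-! ## Sorting by key (computable; fuel-driven, structurally recursive) -/

section Sorting

variable {β : Type*}

/-- Merge step: insert `x` (then continue with `kont`, the merge of the rest of `x`'s run) into a key-sorted run;
structural in the second run, so that the whole merge is structurally recursive (no fuel, no `length`). -/
def mergeStep (x : ℕ × β) (kont : List (ℕ × β) → List (ℕ × β)) : List (ℕ × β) → List (ℕ × β)
  | [] => x :: kont []
  | y :: ys => if x.1 ≤ y.1 then x :: kont (y :: ys) else y :: mergeStep x kont ys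

/-- Merge two key-sorted runs. -/
def mergeByKey : List (ℕ × β) → List (ℕ × β) → List (ℕ × β)
  | [] => fun ys => ys
  | x :: xs => mergeStep x (mergeByKey xs)

/-- One bottom-up pass: merge adjacent runs. -/
def mergePairs : List (List (ℕ × β)) → List (List (ℕ × β))
  | a :: b :: rest => mergeByKey a b :: mergePairs rest
  | L => L

/-- Bottom-up merge sort of a list of runs (fuel = number of passes). -/
def mergeAll : ℕ → List (List (ℕ × β)) → List (ℕ × β)
  | 0, L => L.flatten
  | _ + 1, [] => []
  | _ + 1, [l] => l
  | f + 1, a :: b :: rest => mergeAll f (mergePairs (a :: b :: rest))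

/-- Sort a key-tagged list by key (64 bottom-up passes suffice for any list the kernel will ever see; the passes
after the runs have merged into one cost nothing). -/
def sortByKey (L : List (ℕ × β)) : List (ℕ × β) := mergeAll 64 (L.map fun x => [x])

/-- `mergeStep` permutes. -/
theorem mergeStep_perm (x : ℕ × β) (xs : List (ℕ × β)) (kont : List (ℕ × β) → List (ℕ × β))
    (hk : ∀ zs, (kont zs).Perm (xs ++ zs)) : ∀ (ys : List (ℕ × β)), (mergeStep x kont ys).Perm (x :: xs ++ ys)
  | [] => by
    rw [mergeStep]
    exact (hk []).cons x
  | y :: ys => by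
    rw [mergeStep]
    split_ifs
    · exact (hk _).cons x
    · have h := (mergeStep_perm x xs kont hk ys).cons y
      exact h.trans (List.perm_middle.symm.trans (by simp))

/-- `mergeByKey` permutes. -/
theorem mergeByKey_perm : ∀ (xs ys : List (ℕ × β)), (mergeByKey xs ys).Perm (xs ++ ys)
  | [], ys => by simp [mergeByKey]
  | x :: xs, ys => by
    rw [mergeByKey]
    exact mergeStep_perm x xs _ (mergeByKey_perm xs) ys

/-- `mergePairs` permutes the concatenation. -/
theorem mergePairs_flatten_perm : ∀ (L : List (List (ℕ × β))), (mergePairs L).flatten.Perm L.flatten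
  | [] => by simp [mergePairs]
  | [a] => by simp [mergePairs]
  | a :: b :: rest => by
    simp only [mergePairs, List.flatten_cons]
    have h1 := mergeByKey_perm a b
    have h2 := mergePairs_flatten_perm rest
    simpa [List.append_assoc] using h1.append h2

/-- `mergeAll` permutes the concatenation. -/
theorem mergeAll_perm : ∀ (f : ℕ) (L : List (List (ℕ × β))), (mergeAll f L).Perm L.flatten
  | 0, L => by simp [mergeAll]
  | _ + 1, [] => by simp [mergeAll]
  | _ + 1, [l] => by simp [mergeAll]
  | f + 1, a :: b :: rest => by
    rw [mergeAll]
    exact (mergeAll_perm f _).trans (mergePairs_flatten_perm (a :: b :: rest))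

/-- Concatenating singletons gives the list back. -/
theorem flatten_map_singleton (L : List (ℕ × β)) : (L.map fun x => [x]).flatten = L := by
  induction L with
  | nil => rfl
  | cons x L ih => simp [ih]

/-- `sortByKey` permutes. -/
theorem sortByKey_perm (L : List (ℕ × β)) : (sortByKey L).Perm L := by
  unfold sortByKey
  refine (mergeAll_perm _ _).trans ?_
  rw [flatten_map_singleton]

end Sorting

/-! ## Collect and normalize (computable) -/

section Collect

variable {α : Type*} [LinearOrder α]

/-- Sort by the monomial key, merge equal adjacent monomials, drop zeros. -/
def collect (enc : α → ℕ) (B : ℕ) (P : Poly α) : Poly α :=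
  match (sortByKey (P.map fun mq => (Mono.key enc B mq.1, mq))).map Prod.snd with
  | [] => []
  | mq :: rest => mergeAdj mq.1 mq.2 rest

/-- The normal-ordered, collected form of a term list. -/
def normalize (enc : α → ℕ) (B : ℕ) (T : List (List (α × Bool) × ℚ)) : Poly α := collect enc B (termsToPoly T)

end Collect

end CARPoly

end Summit.Ventures.CertifiedQuantumChemistry
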